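import Summits.BirchSwinnertonDyer.Rank1Residual.GaloisImage.HauptmodulNineValuationVZero
import HarnessLib

/-!
# The `δ`-form of the level-`3` Hauptmodul quartic at `v₃(j) ≥ 7` and the general cube-root lemma
# (cell `b2b-bsdres`, team n1011, seat p02 gen 6 — row T-b11-F4 'scalar-stabiliser tower criterion
# at 9', file F4c-H15 'Hauptmodul route, the unit normalisation at v₃(j) ≢ 0 (mod 3): shared
# algebra'; pure valuation algebra in `ℚ̄`)

HONEST FRAMING (cell `b2b-bsdres`, run/shared/lean/b2b/bsd-rank1-residual/, verbatim in every
file): the goal of the cell is to DELETE the COMBINATION-SHAPED residual classes of the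
Birch–Swinnerton-Dyer formula for ALL analytic-rank `≤ 1` elliptic curves over `ℚ` — "full BSD
formula for every rank `≤ 1` curve in class `C`" assembled STRICTLY from published theorems — so
that the rank-`≤ 1` remainder becomes exactly the CONSTRUCTION-SHAPED classes, which are TYPED
(missing-input `Prop`s), NOT attempted. This is not "finishing BSD". Team n1011 (N10 / N11):
research route; no claim beyond the stated classes; labels UNCHANGED; nothing is booked. Theorems
only (no definition, no named fact).

## What this file proves

`v` the place of `ℚ̄` over `3`, `t = v(3)`.

* `valuation_sub_one_pow_three_eq_of_lt` (§1) — **the cube-root lemma in general form**: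
  `t³ < v(X³ − 1)²` (additively: `ord₃(X³ − 1) < 3/2`) ⟹ `v(X − 1)³ = v(X³ − 1)`
  (`X³ − 1 = (X − 1)(X − ω)(X − ω²)`, `v(1 − ω)² = t`).  Corollaries
  `valuation_sub_one_pow_nine_of_cube_pow_four` (`v(X³ − 1)³ = t⁴ ⟹ v(X − 1)⁹ = t⁴`) and the
  sign-free `valuation_sq_sub_one_pow_nine_of_cube_pow_four` (`v((εX)³ − 1)³ = t⁴`, `ε = ±1`
  ⟹ `v(X² − 1)⁹ = t⁴`).
* `delta_quartic_of_hauptmodul_three` (§2) — the level-`3` relation `j(S − 27) = S(S − 24)³` with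
  `j = 3^{n+3} K`, `S = 3(δ + 8)` reads **`δ³(δ + 8) = 3^n K (δ − 1)`**;
  `valuation_delta_of_quartic` — for `v(K) = 1` and `v(δ + 8) = 1` (non-canonical `S`):
  `v(δ − 1) = 1` and **`v(δ)³ = t^n`**; `valuation_delta_facts_seven` — from `v(δ)³ = t⁴`:
  `v(δ) < t`, `t² < v(δ)`, `v(δ) ≠ 0`.
* `padicValRat_eq_of_nine_dvd_num_sub` / `valuation_facts_of_nine_dvd_num_sub` (§3) — for
  `q ∈ ℚ`, `c ∈ ℤ` with `3 ∤ c` and `9 ∣ num(q/3^V − c)`: `v₃(q) = V`, and in `ℚ̄`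
  `v(q/3^V − c) ≤ t²`, `v(q/3^V) = 1`.

These are the shared inputs of the UNIT NORMALISATION of the Hauptmodul route on the classes
`v₃(j) = V ≥ 7`, `V ≢ 0 (mod 3)` of the EXOTIC core (`HauptmodulNineValuationSeven`,
`…VOne`, `…VTwo`): there `K = j/3^V ≡ ε − 3e₁ (mod 9)` (`ε, e₁ = ±1`) and the invariant is
`z = X² − 1` with `v(X³ − 1) = t^{4/3}` — valuation `4/9`, denominator `9` (128 census cells;
EVIDENCE kit j135897, 128/128).  Nothing booked.

References: [Maier2006] Table 4 (N = 3, 9), §5.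
-/

noncomputable section

set_option maxRecDepth 10000

open scoped Classical

namespace Summit.BirchSwinnertonDyer.Rank1Residual.GaloisImage

open Literature.NumberTheory.EllipticCurves Literature.NumberTheory.GaloisRepresentations
  Rat.HeightOneSpectrum

/-! ### §1 The cube-root lemma, general form -/

/-- **Cube-root lemma.**  If `v(3)³ < v(X³ − 1)²` (i.e. `ord₃(X³ − 1) < 3/2`) then
`v(X − 1)³ = v(X³ − 1)`: with `ω² + ω + 1 = 0`, `X³ − 1 = (X − 1)(X − ω)(X − ω²)` and
`v(1 − ω)² = v(3)`; if `v(X − 1) ≤ v(1 − ω)` the product has `v ≤ v(1 − ω)³`, i.e.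
`v(X³ − 1)² ≤ v(3)³`; otherwise all three factors have valuation `v(X − 1)`. [folklore] -/
theorem valuation_sub_one_pow_three_eq_of_lt {X : AlgebraicClosure ℚ}
    (h : (placeOver 3).valuation (3 : AlgebraicClosure ℚ) ^ 3 <
      (placeOver 3).valuation (X ^ 3 - 1) ^ 2) :
    (placeOver 3).valuation (X - 1) ^ 3 = (placeOver 3).valuation (X ^ 3 - 1) := by
  set v := (placeOver 3).valuation with hv
  set t := v (3 : AlgebraicClosure ℚ) with ht
  -- a primitive cube root of unity `ω = (−1 + δ)/2`, `δ² = −3`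
  obtain ⟨δ, hδ⟩ := IsAlgClosed.exists_pow_nat_eq (-3 : AlgebraicClosure ℚ) (by norm_num : 0 < 2)
  set ω : AlgebraicClosure ℚ := (-1 + δ) / 2 with hω
  have hω2 : ω ^ 2 + ω + 1 = 0 := by
    rw [hω]; field_simp; linear_combination hδ
  have hfac : X ^ 3 - 1 = (X - 1) * ((X - ω) * (X - ω ^ 2)) := by
    linear_combination (X - 1) * (X - ω + 1) * hω2
  have h3 : (1 - ω) * (1 - ω ^ 2) = 3 := by linear_combination (ω - 2) * hω2
  have hω3 : ω ^ 3 = 1 := by linear_combination (ω - 1) * hω2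
  have hvω : v ω = 1 := by
    have h1 : v ω ^ 3 = 1 := by rw [← map_pow, hω3, map_one]
    rcases lt_trichotomy (v ω) 1 with hlt | heq | hgt
    · exact absurd h1 (ne_of_lt (pow_lt_one₀ zero_le hlt (by norm_num)))
    · exact heq
    · exact absurd h1 (ne_of_gt (one_lt_pow₀ hgt (by norm_num)))
  have hb : v (1 - ω ^ 2) = v (1 - ω) := by
    rw [show (1 : AlgebraicClosure ℚ) - ω ^ 2 = (1 - ω) * (1 + ω) by ring, map_mul,
      show (1 : AlgebraicClosure ℚ) + ω = -ω ^ 2 by linear_combination hω2, Valuation.map_neg, map_pow,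
      hvω, one_pow, mul_one]
  set b := v (1 - ω) with hbdef
  have hb2 : b ^ 2 = t := by
    have := congrArg v h3; rw [map_mul, hb] at this; rw [pow_two]; exact this
  set a := v (X - 1) with ha
  have hprod : v (X ^ 3 - 1) = a * (v (X - ω) * v (X - ω ^ 2)) := by rw [hfac, map_mul, map_mul]
  rcases lt_trichotomy a b with hab | hab | hab
  · -- `a < b`: `v(X³ − 1) = a b²`, so `v(X³ − 1)² = a² t² < b² t² = t³`
    exfalso
    have e1 : v (X - ω) = b := by
      rw [show X - ω = (X - 1) + (1 - ω) by ring]; exact Valuation.map_add_eq_of_lt_right _ hab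
    have e2 : v (X - ω ^ 2) = b := by
      rw [show X - ω ^ 2 = (X - 1) + (1 - ω ^ 2) by ring, ← hb]
      exact Valuation.map_add_eq_of_lt_right _ (by rw [hb]; exact hab)
    rw [hprod, e1, e2, ← pow_two, hb2] at h
    have hle : (a * t) ^ 2 ≤ t ^ 3 := by
      calc (a * t) ^ 2 = a ^ 2 * t ^ 2 := mul_pow a t 2
        _ ≤ b ^ 2 * t ^ 2 := mul_le_mul' (pow_le_pow_left₀ zero_le hab.le 2) le_rfl
        _ = t ^ 3 := by rw [hb2, ← pow_succ']
    exact absurd h (not_lt.mpr hle)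
  · -- `a = b`: `v(X³ − 1) ≤ b³`, so `v(X³ − 1)² ≤ b⁶ = t³`
    exfalso
    have e1 : v (X - ω) ≤ b := by
      rw [show X - ω = (X - 1) + (1 - ω) by ring]
      exact (Valuation.map_add _ _ _).trans (max_le hab.le le_rfl)
    have e2 : v (X - ω ^ 2) ≤ b := by
      rw [show X - ω ^ 2 = (X - 1) + (1 - ω ^ 2) by ring]
      exact (Valuation.map_add _ _ _).trans (max_le hab.le hb.le)
    have hle : v (X ^ 3 - 1) ≤ b * (b * b) := by
      rw [hprod, hab]
      exact mul_le_mul' le_rfl (mul_le_mul' e1 e2)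
    have hle2 : v (X ^ 3 - 1) ^ 2 ≤ t ^ 3 := by
      calc v (X ^ 3 - 1) ^ 2 ≤ (b * (b * b)) ^ 2 := pow_le_pow_left₀ zero_le hle 2
        _ = (b ^ 2) ^ 3 := by rw [← pow_three, ← pow_mul, ← pow_mul]
        _ = t ^ 3 := by rw [hb2]
    exact absurd h (not_lt.mpr hle2)
  · -- `a > b`: all three factors have valuation `a`
    have e1 : v (X - ω) = a := by
      rw [show X - ω = (X - 1) + (1 - ω) by ring]; exact Valuation.map_add_eq_of_lt_left _ hab
    have e2 : v (X - ω ^ 2) = a := by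
      rw [show X - ω ^ 2 = (X - 1) + (1 - ω ^ 2) by ring]
      exact Valuation.map_add_eq_of_lt_left _ (by rw [hb]; exact hab)
    rw [hprod, e1, e2]
    exact pow_three a

/-- **`v(X³ − 1)³ = v(3)⁴` forces `v(X − 1)⁹ = v(3)⁴`** (`ord₃(X³ − 1) = 4/3 < 3/2`). [folklore] -/
theorem valuation_sub_one_pow_nine_of_cube_pow_four {X : AlgebraicClosure ℚ}
    (h : (placeOver 3).valuation (X ^ 3 - 1) ^ 3 =
      (placeOver 3).valuation (3 : AlgebraicClosure ℚ) ^ 4) :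
    (placeOver 3).valuation (X - 1) ^ 9 = (placeOver 3).valuation (3 : AlgebraicClosure ℚ) ^ 4 := by
  set v := (placeOver 3).valuation with hv
  set t := v (3 : AlgebraicClosure ℚ) with ht
  have ht1 : t < 1 := valuation_three_lt_one
  have ht0 : t ≠ 0 := valuation_three_ne_zero
  have hlt : t ^ 3 < v (X ^ 3 - 1) ^ 2 := by
    refine lt_of_pow_lt_pow_left₀ 3 zero_le ?_
    calc (t ^ 3) ^ 3 = t ^ 9 := by rw [← pow_mul]
      _ < t ^ 8 := (pow_lt_pow_iff_of_lt_one' ht0 ht1).mpr (by norm_num)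
      _ = (v (X ^ 3 - 1) ^ 3) ^ 2 := by rw [h, ← pow_mul]
      _ = (v (X ^ 3 - 1) ^ 2) ^ 3 := by rw [← pow_mul, ← pow_mul]
  have h3 := valuation_sub_one_pow_three_eq_of_lt hlt
  calc v (X - 1) ^ 9 = (v (X - 1) ^ 3) ^ 3 := by rw [← pow_mul]
    _ = v (X ^ 3 - 1) ^ 3 := by rw [h3]
    _ = t ^ 4 := h

/-- **Sign-free form**: for `ε = ±1`, `v((εX)³ − 1)³ = v(3)⁴ ⟹ v(X² − 1)⁹ = v(3)⁴`
(`X² − 1 = (εX − 1)(εX + 1)` and `εX + 1 = 2 + (εX − 1)` is a unit). [folklore] -/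
theorem valuation_sq_sub_one_pow_nine_of_cube_pow_four {X ε : AlgebraicClosure ℚ}
    (hε : ε = 1 ∨ ε = -1)
    (h : (placeOver 3).valuation ((ε * X) ^ 3 - 1) ^ 3 =
      (placeOver 3).valuation (3 : AlgebraicClosure ℚ) ^ 4) :
    (placeOver 3).valuation (X ^ 2 - 1) ^ 9 = (placeOver 3).valuation (3 : AlgebraicClosure ℚ) ^ 4 := by
  set v := (placeOver 3).valuation with hv
  set t := v (3 : AlgebraicClosure ℚ) with ht
  have ht1 : t < 1 := valuation_three_lt_one
  have hsq : ε ^ 2 = 1 := by rcases hε with h | h <;> rw [h] <;> norm_num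
  have hX1 := valuation_sub_one_pow_nine_of_cube_pow_four h
  have hfac : X ^ 2 - 1 = (ε * X - 1) * (ε * X + 1) := by linear_combination (-X ^ 2) * hsq
  have hXlt : v (ε * X - 1) < 1 := by
    by_contra hge
    rw [not_lt] at hge
    have : (1 : _) ≤ v (ε * X - 1) ^ 9 := one_le_pow₀ hge
    rw [hX1] at this
    exact absurd (pow_lt_one₀ zero_le ht1 (by norm_num : (4 : ℕ) ≠ 0)) (not_lt.mpr this)
  have hunit : v (ε * X + 1) = 1 := by
    have e : ε * X + 1 = 2 + (ε * X - 1) := by ring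
    have h2 : v (2 : AlgebraicClosure ℚ) = 1 := by
      simpa using valuation_intCast_eq_one_of_not_dvd (n := 2) (by decide)
    rw [e, Valuation.map_add_eq_of_lt_left _ (by rw [h2]; exact hXlt), h2]
  rw [hfac, map_mul, hunit, mul_one, hX1]

/-! ### §2 The `δ`-form of the level-`3` quartic and the valuation of `δ` -/

/-- **The `δ`-form of the level-`3` relation.**  `j(S − 27) = S(S − 24)³` with `j = 3^{n+3} K`
and `S = 3(δ + 8)` reads `δ³(δ + 8) = 3^n K (δ − 1)` (at `j = 0` the quartic in `ρ = S/3 − 2` is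
`(ρ − 6)³(ρ + 2)`, `δ = ρ − 6`). [cite: Maier2006, Table 4 (N = 3)] -/
theorem delta_quartic_of_hauptmodul_three {F : Type*} [Field F] [CharZero F] {j S δ K : F}
    {n : ℕ} (hj : j = 3 ^ (n + 3) * K)
    (hS : j * (S - 27) = S * (S - 24) ^ 3) (hδ : S = 3 * (δ + 8)) :
    δ ^ 3 * (δ + 8) = 3 ^ n * K * (δ - 1) := by
  rw [hj, hδ, pow_add] at hS
  have h0 : (81 : F) * (δ ^ 3 * (δ + 8) - 3 ^ n * K * (δ - 1)) = 0 := by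
    linear_combination (-1 : F) * hS
  have h81 : (81 : F) ≠ 0 := by norm_num
  exact sub_eq_zero.mp ((mul_eq_zero.mp h0).resolve_left h81)

/-- **`v(δ − 1) = 1` and `v(δ)³ = v(3)^n`** for a solution of `δ³(δ + 8) = 3^n K (δ − 1)` with
`v(K) = 1` and `v(δ + 8) = 1` (the non-canonical root: `δ + 8 = S/3` is a unit, so is
`δ − 1 = (δ + 8) − 9`). [folklore] -/
theorem valuation_delta_of_quartic {δ K : AlgebraicClosure ℚ} {n : ℕ}
    (hK : (placeOver 3).valuation K = 1)
    (h8 : (placeOver 3).valuation (δ + 8) = 1)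
    (hR : δ ^ 3 * (δ + 8) = (3 : AlgebraicClosure ℚ) ^ n * K * (δ - 1)) :
    (placeOver 3).valuation (δ - 1) = 1 ∧
      (placeOver 3).valuation δ ^ 3 = (placeOver 3).valuation (3 : AlgebraicClosure ℚ) ^ n := by
  set v := (placeOver 3).valuation with hv
  set t := v (3 : AlgebraicClosure ℚ) with ht
  have ht1 : t < 1 := valuation_three_lt_one
  have h1 : v (δ - 1) = 1 := by
    have e : δ - 1 = (δ + 8) - 9 := by ring
    have h9 : v (9 : AlgebraicClosure ℚ) < v (δ + 8) := by
      rw [h8, show (9 : AlgebraicClosure ℚ) = 3 ^ 2 by norm_num, map_pow]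
      exact pow_lt_one₀ zero_le ht1 two_ne_zero
    rw [e, valuation_sub_eq_of_lt h9, h8]
  refine ⟨h1, ?_⟩
  have := congrArg v hR
  rw [map_mul, map_pow, h8, mul_one, map_mul, map_mul, map_pow, hK, mul_one, h1, mul_one] at this
  exact this

/-! ### §2b Small valuation facts from `v(δ)³ = v(3)⁴` (`v₃(j) = 7`) -/

/-- From `v(δ)³ = v(3)⁴`: `v(δ) < v(3)`, `v(3)² < v(δ)`, `v(δ) ≠ 0`. [folklore] -/
theorem valuation_delta_facts_seven {δ : AlgebraicClosure ℚ}
    (hδ : (placeOver 3).valuation δ ^ 3 = (placeOver 3).valuation (3 : AlgebraicClosure ℚ) ^ 4) :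
    (placeOver 3).valuation δ < (placeOver 3).valuation (3 : AlgebraicClosure ℚ) ∧
      (placeOver 3).valuation (3 : AlgebraicClosure ℚ) ^ 2 < (placeOver 3).valuation δ ∧
      (placeOver 3).valuation δ ≠ 0 := by
  set v := (placeOver 3).valuation with hv
  set t := v (3 : AlgebraicClosure ℚ) with ht
  set s := v δ with hs
  have ht1 : t < 1 := valuation_three_lt_one
  have ht0 : t ≠ 0 := valuation_three_ne_zero
  refine ⟨?_, ?_, ?_⟩
  · refine lt_of_pow_lt_pow_left₀ 3 zero_le ?_
    rw [hδ]
    exact (pow_lt_pow_iff_of_lt_one' ht0 ht1).mpr (by norm_num)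
  · refine lt_of_pow_lt_pow_left₀ 3 zero_le ?_
    rw [hδ, ← pow_mul]
    exact (pow_lt_pow_iff_of_lt_one' ht0 ht1).mpr (by norm_num)
  · intro h0
    rw [h0, zero_pow three_ne_zero] at hδ
    exact pow_ne_zero 4 ht0 hδ.symm

/-! ### §3 `9 ∣ num(q/3^V − c)` with `3 ∤ c` -/

/-- **`9 ∣ num(q/3^V − c)` with `3 ∤ c` forces `v₃(q) = V`** (and `q/3^V` is a `3`-adic unit
`≡ c (mod 9)`). [folklore] -/
theorem padicValRat_eq_of_nine_dvd_num_sub {q : ℚ} {V : ℕ} {c : ℤ} (hc : ¬ (3 : ℤ) ∣ c)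
    (h : (9 : ℤ) ∣ (q / 3 ^ V - c).num) :
    padicValRat 3 q = (V : ℤ) ∧ padicValRat 3 (q / 3 ^ V) = 0 ∧ q / 3 ^ V ≠ 0 := by
  haveI : Fact (Nat.Prime 3) := ⟨Nat.prime_three⟩
  have hc0 : (c : ℚ) ≠ 0 := by
    have : c ≠ 0 := by rintro rfl; exact hc (dvd_zero 3)
    exact_mod_cast this
  have hvc : padicValRat 3 (c : ℚ) = 0 := by
    rw [padicValRat.of_int]
    have : padicValInt 3 c = 0 := padicValInt.eq_zero_of_not_dvd hc
    exact_mod_cast this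
  -- `v₃(q/3^V) = 0`
  have hq0 : padicValRat 3 (q / 3 ^ V) = 0 ∧ q / 3 ^ V ≠ 0 := by
    have e : q / 3 ^ V = (c : ℚ) + (q / 3 ^ V - c) := by ring
    by_cases hz : q / 3 ^ V - c = 0
    · rw [e, hz, add_zero]; exact ⟨hvc, hc0⟩
    have h2 := two_le_padicValRat_of_nine_dvd_num hz h
    have hne : (c : ℚ) + (q / 3 ^ V - c) ≠ 0 := by
      intro h0
      have e' : q / 3 ^ V - c = -(c : ℚ) := by linear_combination h0
      rw [e', padicValRat.neg, hvc] at h2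
      norm_num at h2
    refine ⟨?_, by rw [e]; exact hne⟩
    rw [e, padicValRat.add_eq_min hne hc0 hz (by rw [hvc]; omega), hvc]
    exact min_eq_left (by omega)
  have hq : q = 3 ^ V * (q / 3 ^ V) := by
    rw [mul_div_cancel₀ _ (pow_ne_zero _ (by norm_num : (3 : ℚ) ≠ 0))]
  have h33 : padicValRat 3 (3 : ℚ) = 1 := by exact_mod_cast padicValRat.self (p := 3) (by norm_num)
  refine ⟨?_, hq0.1, hq0.2⟩
  rw [hq, padicValRat.mul (pow_ne_zero _ (by norm_num)) hq0.2, hq0.1, padicValRat.pow, h33]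
  · ring

/-- In `ℚ̄`: for `q ∈ ℚ`, `c ∈ ℤ`, `3 ∤ c`, `9 ∣ num(q/3^V − c)`, with `K = q/3^V` read in `ℚ̄`:
**`v(K − c) ≤ v(3)²`, `v(K) = 1`, and `q = 3^V K`**. [folklore] -/
theorem valuation_facts_of_nine_dvd_num_sub {q : ℚ} {V : ℕ} {c : ℤ} (hc : ¬ (3 : ℤ) ∣ c)
    (h : (9 : ℤ) ∣ (q / 3 ^ V - c).num) :
    (placeOver 3).valuation (algebraMap ℚ (AlgebraicClosure ℚ) (q / 3 ^ V) - c) ≤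
        (placeOver 3).valuation (3 : AlgebraicClosure ℚ) ^ 2 ∧
      (placeOver 3).valuation (algebraMap ℚ (AlgebraicClosure ℚ) (q / 3 ^ V)) = 1 ∧
      algebraMap ℚ (AlgebraicClosure ℚ) q =
        3 ^ V * algebraMap ℚ (AlgebraicClosure ℚ) (q / 3 ^ V) := by
  set v := (placeOver 3).valuation with hv
  set t := v (3 : AlgebraicClosure ℚ) with ht
  have ht1 : t < 1 := valuation_three_lt_one
  set K := algebraMap ℚ (AlgebraicClosure ℚ) (q / 3 ^ V) with hKdef
  have hKc : v (K - c) ≤ t ^ 2 := by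
    have e : K - (c : AlgebraicClosure ℚ) = algebraMap ℚ (AlgebraicClosure ℚ) (q / 3 ^ V - c) := by
      rw [map_sub, map_intCast]
    rw [e]
    exact valuation_algebraMap_le_sq_of_nine_dvd_num h
  have hvc : v (c : AlgebraicClosure ℚ) = 1 := valuation_intCast_eq_one_of_not_dvd hc
  have hK : v K = 1 := by
    have e : K = (K - c) + c := by ring
    have hlt : v (K - (c : AlgebraicClosure ℚ)) < v (c : AlgebraicClosure ℚ) := by
      rw [hvc]; exact hKc.trans_lt (pow_lt_one₀ zero_le ht1 two_ne_zero)
    rw [e, Valuation.map_add_eq_of_lt_right _ hlt, hvc]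
  refine ⟨hKc, hK, ?_⟩
  rw [hKdef, map_div₀, map_pow, map_ofNat,
    mul_div_cancel₀ _ (pow_ne_zero _ (by norm_num : (3 : AlgebraicClosure ℚ) ≠ 0))]

end Summit.BirchSwinnertonDyer.Rank1Residual.GaloisImage
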